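import Literature.MathematicalPhysics.QuantumFieldTheory.Balaban1983to89.B5Hk163Torus
import Literature.MathematicalPhysics.QuantumFieldTheory.Balaban1983to89.B5Hk163HolderEuclid
import Literature.MathematicalPhysics.QuantumFieldTheory.Balaban1983to89.Beta.WoodburyFibre

/-!
# `Balaban1983to89.B5Hk163TorusHolder` — the printed HÖLDER CONSEQUENCE of (1.63) for the TYPED torus operator:
`|∂_ν(H_kB)_μ(x′) − ∂_ν(H_kB)_μ(x)| ≤ C·|x′ − x|^α·Σ|B|`, uniformly in the lattice spacing
(cell GAPS G-b05g10-5; successor of `B5Hk163Torus`, `B5Hk163HolderEuclid`; the elementary `|e^{ip·x}| = 1` is reused from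
`Beta.WoodburyFibre` BY NAME, nothing else of that module is used)

T. Bałaban, *Propagators and renormalization transformations for lattice gauge theories. I*, Commun. Math. Phys.
**95**, 17–40 (1984) [`Balaban1984PropagatorsI`, cell paper B5].  PRINTED TEXT (locations only; renders
`…rt-I-p012-x2.png`, `…-p013-x2.png` (pp. 28–29 [PDF 12–13]) and `…-p007-x2.png` (p. 23 [PDF 7]) read as images by
the author of this file).  After the momentum display (1.63) of `H_kB`, p. 28 bottom – p. 29 top, verbatim:
«This expression is well defined and bounded for all values of l and p′, including p′ = 0 where it is defined as a
limit for p′ → 0. Another important property is that the sum over l of the absolute value of this expression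
multiplied by |∂_ν(p′+l)||p′+l|^α is bounded by a constant dependent on d only. This implies bounds on
(1/|x′−x|^α)|∂_ν(H_kB)_μ(x′) − ∂_ν(H_kB)_μ(x)| (see the proof of Lemma 2.4 in [2].)»  No proof and no precise
form of the implied bound are printed.  The derivative symbol `∂_μ(p) = (e^{iηp_μ} − 1)/η` is (1.31), p. 23.

The second quoted sentence (the weighted alias sum) is certified by `B5Hk163Holder.weighted_alias_sum_le_real` and,
with the Euclidean length `|p′+l|`, by `B5Hk163HolderEuclid.weighted_alias_sum_le_euclid`; the typed torus operator
`H_k = B5Hk163Torus.HkOp` realises (1.63) (`B5Hk163Torus.QvOp_mul_HkOp`, `dft_HkOp`).  THIS MODULE certifies the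
THIRD sentence — the implication «This implies bounds on …» — for that typed operator, in the torus model of the
b05 lineage, with OUR constants.  Everything below is `[folklore]` Fourier bookkeeping on finite tori; every
`[cite: …]` tag is a TEXT LOCATION; nothing printed enters as a hypothesis (ABSOLUTE RULE).

## Typed reading (ours, not a printed display)

* fine torus `T_η = Π_ν ℤ/(nM_ν)` (`B5Prop11Plancherel.Tor (fine n M)`, integer coordinates, `η = 1/n`, `n = L^k`),
  coarse (unit) torus `T₁ = Π_ν ℤ/M_ν`; `∂_ν` = the `η`-lattice forward derivative `η⁻¹(f(x + ηe_ν) − f(x))`, typed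
  as the vector-index difference `B5Prop11Plancherel.fdiff (fine n M) (n : ℂ) ν` (symbol (1.31),
  `B5Prop11Plancherel.fsym`); so `∂_ν(H_kB)` is the fine 1-form `fdiff (fine n M) n ν *ᵥ (HkOp n M *ᵥ B)` and
  `∂_νH_k` is the matrix `fdiff (fine n M) n ν * HkOp n M`;
* its kernel is `dker μ λ ν x′ y = |T₁|⁻¹ Σ_{(l,p′)} e^{i(p′+l)·x′} ∂_ν(p′+l) e^{−ip′·y} h_{l;μλ}(p′)` (`dker_eq`): the
  fine character of `p′+l` at one fine step is `e^{iη(p′_ν+l_ν)}` (`B5Block118.chi_pOf_tstep`), whence the factor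
  `∂_ν(p′+l) = n(e^{iη(p′_ν+l_ν)} − 1) = B5Prop11Fiber.dSym`;
* `x′ − x` is represented by an integer vector `z ∈ ℤ^d` of fine steps (`x′ = x + z̄`,
  `z̄ = B6LowerBound2153Torus.toT (fine n M) z`), of physical Euclidean length `|x′ − x| = η‖z‖₂ = zlen z / n`; the
  bounds hold for EVERY representative `z` of the torus displacement, in particular for the shortest one.

## Content (sorry-free)

* §1 phases (`|e^{ip·x}| = 1` is `Beta.WoodburyFibre.norm_chi`, BY NAME): `chi_pOf_unitVec` (`e^{i(p′+l)·ηe_ν} = ω_ν`),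
  `stdAddChar_pOf_mul_intCast`, `exp_shiftr_eq_exp_symmAlias` and `chi_pOf_toT` (`e^{i(p′+l)·ηz} = e^{iθ}` with
  `θ = η q̃·z`, `q̃ = King1986.symmAlias n l p′` the centred representative of `p′+l` in `[−πn, πn]^d` — the
  pull-back by `2πn` costs `e^{2πi·integer} = 1`), `norm_exp_mul_I_sub_one_le_rpow` (`|e^{iθ} − 1| ≤ 2^{1−α}|θ|^α`,
  `0 ≤ α ≤ 1`), `abs_theta_le` (Cauchy–Schwarz `|θ| ≤ |q̃|·‖z‖₂/n`), and `norm_chi_pOf_toT_sub_one_le`: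
  `|e^{i(p′+l)·ηz} − 1| ≤ 2^{1−α} |q̃|^α (‖z‖₂/n)^α`;
* §2 the typed `∂_νH_k`: `dker`, `fdiff_HkOp_apply` (the matrix entry of `fdiff * HkOp` IS `dker`),
  `fdiff_HkOp_mulVec` (`∂_ν(H_kB)_μ(x′) = Σ_{y,λ} dker·B_λ(y)`), `dker_eq` (the momentum form above), and the
  SUP BOUND `norm_dker_le`: `|∂_νH_k((x′,μ),(y,λ))| ≤ C_H(d, 0)` (the weighted alias sum at `α = 0`), with its
  operator form `norm_fdiff_HkOp_mulVec_le`;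
* §3 THE HÖLDER BOUND: `dker_transl_sub`
  (`dker(x′+z̄) − dker(x′) = |T₁|⁻¹Σ e^{i(p′+l)x′}(e^{i(p′+l)ηz} − 1)∂_ν(p′+l)e^{−ip′y}h_{l;μλ}(p′)`),
  **`norm_dker_transl_sub_le`**: for `d ≥ 1`, every `n ≥ 1`, every period vector `M`, all `μ, λ, ν, x′, y`, every
  `z ∈ ℤ^d` and `0 ≤ α < 1`,
  `|∂_νH_k((x′+z̄, μ),(y,λ)) − ∂_νH_k((x′,μ),(y,λ))| ≤ C_HT(d,α) · (‖z‖₂/n)^α`,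
  `C_HT(d,α) = 2^{1−α}(π/2)^α C_H(d,α)` (`CHolderTorus`; per torus momentum `p′` the `l`-sum is
  `weighted_alias_sum_le_euclid`, then `|T₁|⁻¹Σ_{p′} 1 = 1`); the quotient form `holder_quotient_dker_le`
  (`|…| / (η‖z‖₂)^α ≤ C_HT(d,α)` for `z ≠ 0`), the matrix-entry form `norm_fdiff_HkOp_apply_sub_le`, and the
  operator form **`norm_fdiff_HkOp_mulVec_sub_le`**:
  `|∂_ν(H_kB)_μ(x′+z̄) − ∂_ν(H_kB)_μ(x′)| ≤ C_HT(d,α)(‖z‖₂/n)^α · Σ_{y,λ}|B_λ(y)|`.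

## Honest scope

(i) TORUS MODEL ONLY (finite periodic lattices), as in the whole b05 lineage.  (ii) The bounds are KERNEL SUP-NORM /
`ℓ¹(B)` bounds: no decay of the Hölder-difference kernel in `y` is claimed here (the undifferenced kernel decays
exponentially, `B5Hk163Torus.norm_HkOp_le`; a decaying Hölder kernel would need the strip version
`B5Hk163Holder.weighted_alias_sum_le` plus a contour shift and is left open).  (iii) The constant
`C_HT(d,α) = 2^{1−α}(π/2)^α·CHolder163 d α` is ours, crude, depends on `d` AND `α` and diverges as `α → 1` (print:
«dependent on d only», `α` a fixed exponent).  (iv) `|x′ − x|` is `η` times the Euclidean length of the chosen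
integer representative.  (v) `U = 1`, `m² = 0`.  Value = kernel certificate of a printed, unproved claim of B5,
NOT summit progress, NOT continuum, NOT Clay.
-/

open scoped BigOperators Matrix ComplexConjugate Real
open Finset Complex

namespace Literature.MathematicalPhysics.QuantumFieldTheory.Balaban1983to89.B5Hk163TorusHolder

open Literature.MathematicalPhysics.QuantumFieldTheory.Balaban1983to89.B4Strip (ofRealVec shiftr)
open Literature.MathematicalPhysics.QuantumFieldTheory.Balaban1983to89.B4ContourShift (BZ)
open Literature.MathematicalPhysics.QuantumFieldTheory.Balaban1983to89.B5Prop11Plancherel (Tor chi fine sOf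
  unitVec fdiff conj_chi chi_add_right abs_sOf_le)
open Literature.MathematicalPhysics.QuantumFieldTheory.Balaban1983to89.B5Prop11Fiber (dSym)
open Literature.MathematicalPhysics.QuantumFieldTheory.Balaban1983to89.B5Action121 (comp fdiff_mulVec_apply
  sdiff_mulVec)
open Literature.MathematicalPhysics.QuantumFieldTheory.Balaban1983to89.B5Block118 (pOf om dSym_eq_om tstep
  tstep_zero tstep_succ chi_pOf_tstep)
open Literature.MathematicalPhysics.QuantumFieldTheory.Balaban1983to89.B5Hk163Strip (dC dC_ofReal h163)
open Literature.MathematicalPhysics.QuantumFieldTheory.Balaban1983to89.B5Hk163Holder (wt163 CHolder163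
  weighted_alias_sum_le_real)
open Literature.MathematicalPhysics.QuantumFieldTheory.Balaban1983to89.B5Hk163HolderEuclid
  (weighted_alias_sum_le_euclid)
open Literature.MathematicalPhysics.QuantumFieldTheory.Balaban1983to89.B5Hk163Torus (hker HkOp HkOp_mulVec)
open Literature.MathematicalPhysics.QuantumFieldTheory.Balaban1983to89.B6LowerBound2153Torus (toT)
open Literature.MathematicalPhysics.QuantumFieldTheory.Balaban1983to89.Beta.WoodburyFibre (norm_chi)
open Literature.MathematicalPhysics.QuantumFieldTheory.King1986 (symmAlias symmShift momSq momSq_nonneg)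

noncomputable section

variable {d : ℕ}

/-! ## §1. Phases: the fine character of `p′ + l` at one step and at an integer displacement -/

section Phases

/-- the Euclidean length `‖z‖₂ = (Σ_ν z_ν²)^{1/2}` of an integer displacement `z ∈ ℤ^d` (in fine lattice steps; the
physical length of `ηz` is `‖z‖₂/n`). [folklore] -/
def zlen (z : Fin d → ℤ) : ℝ := Real.sqrt (∑ ν, ((z ν : ℝ)) ^ 2)

/-- `‖z‖₂ ≥ 0`. [folklore] -/
theorem zlen_nonneg (z : Fin d → ℤ) : 0 ≤ zlen z := Real.sqrt_nonneg _

/-- `z ≠ 0 ⇒ ‖z‖₂ > 0`. [folklore] -/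
theorem zlen_pos {z : Fin d → ℤ} (hz : z ≠ 0) : 0 < zlen z := by
  obtain ⟨ν, hν⟩ := Function.ne_iff.mp hz
  unfold zlen
  apply Real.sqrt_pos.mpr
  have h1 : (0 : ℝ) < ((z ν : ℝ)) ^ 2 := by
    have : (z ν : ℝ) ≠ 0 := by exact_mod_cast hν
    positivity
  exact lt_of_lt_of_le h1
    (Finset.single_le_sum (f := fun i => ((z i : ℝ)) ^ 2) (fun i _ => sq_nonneg _) (Finset.mem_univ ν))

/-- `|e^{iθ} − 1| ≤ 2^{1−α}|θ|^α` for `0 ≤ α ≤ 1` (interpolating `|e^{iθ} − 1| ≤ 2` and `|e^{iθ} − 1| ≤ |θ|`,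
Mathlib `Real.norm_exp_I_mul_ofReal_sub_one_le`). [folklore] -/
theorem norm_exp_mul_I_sub_one_le_rpow (θ : ℝ) {α : ℝ} (hα0 : 0 ≤ α) (hα1 : α ≤ 1) :
    ‖Complex.exp ((θ : ℂ) * I) - 1‖ ≤ (2 : ℝ) ^ (1 - α) * |θ| ^ α := by
  set a : ℝ := ‖Complex.exp ((θ : ℂ) * I) - 1‖ with ha_def
  have ha0 : 0 ≤ a := norm_nonneg _
  have ha2 : a ≤ 2 := by
    calc a ≤ ‖Complex.exp ((θ : ℂ) * I)‖ + ‖(1 : ℂ)‖ := norm_sub_le _ _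
      _ = 2 := by rw [Complex.norm_exp_ofReal_mul_I, norm_one]; norm_num
  have haθ : a ≤ |θ| := by
    have h := Real.norm_exp_I_mul_ofReal_sub_one_le (x := θ)
    rw [Real.norm_eq_abs, mul_comm] at h
    exact h
  have hsplit : a = a ^ (1 - α) * a ^ α := by
    rw [← Real.rpow_add' ha0 (by norm_num : (1 - α) + α ≠ 0), show (1 - α) + α = 1 by ring, Real.rpow_one]
  rw [hsplit]
  exact mul_le_mul (Real.rpow_le_rpow ha0 ha2 (by linarith)) (Real.rpow_le_rpow ha0 haθ hα0)
    (Real.rpow_nonneg ha0 _) (Real.rpow_nonneg (by norm_num) _)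

variable (n : ℕ) [NeZero n] (M : Fin d → ℕ) [hM : ∀ μ, NeZero (M μ)]

/-- a torus momentum `p′ = sOf M q` lies in the Brillouin zone `[−π, π]^d`. [folklore] -/
theorem sOf_mem_BZ (q : Tor M) : sOf M q ∈ BZ d :=
  ⟨fun ν => (abs_le.mp (abs_sOf_le M q ν)).1, fun ν => (abs_le.mp (abs_sOf_le M q ν)).2⟩

/-- ONE FINE STEP: `e^{i(p′+l)·ηe_ν} = ω_ν = e^{iη(p′_ν+l_ν)}` (`B5Block118.chi_pOf_tstep` at `t = 1`), so that the
forward difference `η⁻¹(S_ν − 1)` acts on the character by `n(ω_ν − 1) = ∂_ν(p′+l)`.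
[cite: Balaban1984PropagatorsI, (1.31) p.23 (the symbol ∂_μ(p) = (e^{iηp_μ} − 1)/η)] [folklore] -/
theorem chi_pOf_unitVec (k : Fin d → Fin n) (q : Tor M) (ν : Fin d) :
    chi (fine n M) (pOf n M (k, q)) (unitVec (fine n M) ν) = om n k (sOf M q) ν := by
  have h : unitVec (fine n M) ν = tstep (fine n M) ν 1 := by
    have h1 := tstep_succ (fine n M) ν 0
    rw [tstep_zero, zero_add, zero_add] at h1
    exact h1.symm
  rw [h, chi_pOf_tstep, pow_one]

/-- `e^{2πi(v + Mk)z/(nM)} = e^{iη(p′_ν + l_ν)z}` for an integer number `z` of fine steps in direction `ν`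
(the integer analogue of `B5Block118.stdAddChar_pOf_mul_natCast`). [folklore] -/
theorem stdAddChar_pOf_mul_intCast (k : Fin d → Fin n) (q : Tor M) (ν : Fin d) (z : ℤ) :
    (ZMod.stdAddChar (N := fine n M ν)) (pOf n M (k, q) ν * (z : ZMod (fine n M ν)))
      = Complex.exp (((shiftr n k (sOf M q) ν * z / n : ℝ) : ℂ) * I) := by
  have hMc : (M ν : ℂ) ≠ 0 := by exact_mod_cast NeZero.ne (M ν)
  have hnc : (n : ℂ) ≠ 0 := by exact_mod_cast NeZero.ne n
  have h1 : pOf n M (k, q) ν * (z : ZMod (fine n M ν))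
      = ((((q ν).valMinAbs + (M ν : ℤ) * ((k ν : ℕ) : ℤ)) * z : ℤ) : ZMod (fine n M ν)) := by
    simp only [pOf]
    push_cast
    ring
  rw [h1, ZMod.stdAddChar_coe]
  congr 1
  unfold shiftr sOf
  simp only [fine]
  push_cast
  field_simp

omit hM in
/-- the pull-back to the centred representative costs nothing: `e^{iη(p′_ν+l_ν)z} = e^{iη q̃_ν z}` for an INTEGER
`z` (`q̃_ν = p′_ν + l_ν − 2πn·[p′_ν + l_ν > πn]` = `King1986.symmAlias`; the difference of the exponents is
`2πi·[…]·z ∈ 2πiℤ`). [folklore] -/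
theorem exp_shiftr_eq_exp_symmAlias (k : Fin d → Fin n) (s : Fin d → ℝ) (ν : Fin d) (z : ℤ) :
    Complex.exp (((shiftr n k s ν * z / n : ℝ) : ℂ) * I)
      = Complex.exp (((symmAlias n k s ν * z / n : ℝ) : ℂ) * I) := by
  have hnc : (n : ℂ) ≠ 0 := by exact_mod_cast NeZero.ne n
  rw [Complex.exp_eq_exp_iff_exists_int]
  refine ⟨(symmShift n k s ν : ℤ) * z, ?_⟩
  unfold symmAlias
  push_cast
  field_simp
  ring

/-- the phase `θ = η q̃·z = (Σ_ν q̃_ν z_ν)/n` of the centred fine momentum `q̃` against the displacement `ηz`.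
[folklore] -/
def theta (k : Fin d → Fin n) (s : Fin d → ℝ) (z : Fin d → ℤ) : ℝ := (∑ ν, symmAlias n k s ν * (z ν : ℝ)) / n

/-- `e^{i(p′+l)·ηz} = e^{iθ}`: the fine character of `p′ + l` at the class of the integer vector `z`. [folklore] -/
theorem chi_pOf_toT (k : Fin d → Fin n) (q : Tor M) (z : Fin d → ℤ) :
    chi (fine n M) (pOf n M (k, q)) (toT (fine n M) z) = Complex.exp ((theta n k (sOf M q) z : ℂ) * I) := by
  unfold chi
  have hfac : ∀ ν, (ZMod.stdAddChar (N := fine n M ν)) (pOf n M (k, q) ν * toT (fine n M) z ν)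
      = Complex.exp (((symmAlias n k (sOf M q) ν * z ν / n : ℝ) : ℂ) * I) := by
    intro ν
    rw [show toT (fine n M) z ν = ((z ν : ℤ) : ZMod (fine n M ν)) from rfl, stdAddChar_pOf_mul_intCast,
      exp_shiftr_eq_exp_symmAlias]
  simp_rw [hfac]
  rw [← Complex.exp_sum, theta]
  congr 1
  push_cast
  rw [Finset.sum_div, Finset.sum_mul]

omit hM in
/-- CAUCHY–SCHWARZ: `|θ| ≤ |q̃|·‖z‖₂/n` (`|q̃|² = King1986.momSq q̃`). [folklore] -/
theorem abs_theta_le (k : Fin d → Fin n) (s : Fin d → ℝ) (z : Fin d → ℤ) :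
    |theta n k s z| ≤ Real.sqrt (momSq (symmAlias n k s)) * zlen z / n := by
  have hn : (0 : ℝ) < n := by exact_mod_cast Nat.pos_of_ne_zero (NeZero.ne n)
  have hcs := Finset.sum_mul_sq_le_sq_mul_sq Finset.univ (fun ν => symmAlias n k s ν) (fun ν => (z ν : ℝ))
  have h1 : |∑ ν, symmAlias n k s ν * (z ν : ℝ)| ≤ Real.sqrt (momSq (symmAlias n k s)) * zlen z := by
    rw [zlen, ← Real.sqrt_mul (momSq_nonneg _)]
    exact Real.abs_le_sqrt (by simpa [momSq] using hcs)
  unfold theta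
  rw [abs_div, abs_of_pos hn]
  gcongr

/-- **THE PHASE BOUND**: `|e^{i(p′+l)·ηz} − 1| ≤ 2^{1−α}·|q̃|^α·(‖z‖₂/n)^α` for `0 ≤ α ≤ 1` — the only place where
the displacement enters; the factor `|q̃|^α = momSq(q̃)^{α/2}` is the printed weight `|p′+l|^α`. [folklore] -/
theorem norm_chi_pOf_toT_sub_one_le (k : Fin d → Fin n) (q : Tor M) (z : Fin d → ℤ) {α : ℝ} (hα0 : 0 ≤ α)
    (hα1 : α ≤ 1) :
    ‖chi (fine n M) (pOf n M (k, q)) (toT (fine n M) z) - 1‖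
      ≤ (2 : ℝ) ^ (1 - α) * momSq (symmAlias n k (sOf M q)) ^ (α / 2) * (zlen z / n) ^ α := by
  have hn : (0 : ℝ) < n := by exact_mod_cast Nat.pos_of_ne_zero (NeZero.ne n)
  have hm0 : 0 ≤ momSq (symmAlias n k (sOf M q)) := momSq_nonneg _
  have hz0 : 0 ≤ zlen z := zlen_nonneg z
  rw [chi_pOf_toT]
  refine (norm_exp_mul_I_sub_one_le_rpow _ hα0 hα1).trans ?_
  rw [mul_assoc]
  refine mul_le_mul_of_nonneg_left ?_ (Real.rpow_nonneg (by norm_num) _)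
  calc |theta n k (sOf M q) z| ^ α
      ≤ (Real.sqrt (momSq (symmAlias n k (sOf M q))) * zlen z / n) ^ α :=
        Real.rpow_le_rpow (abs_nonneg _) (abs_theta_le n k (sOf M q) z) hα0
    _ = momSq (symmAlias n k (sOf M q)) ^ (α / 2) * (zlen z / n) ^ α := by
        rw [mul_div_assoc, Real.mul_rpow (Real.sqrt_nonneg _) (div_nonneg hz0 hn.le), Real.sqrt_eq_rpow,
          ← Real.rpow_mul hm0]
        congr 2
        ring

end Phases

/-! ## §2. The typed `∂_νH_k`: its kernel, the momentum form, the sup bound -/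

section Operator

variable (n : ℕ) [NeZero n] (M : Fin d → ℕ) [hM : ∀ μ, NeZero (M μ)]

/-- THE KERNEL OF THE TYPED `∂_νH_k`: `dker μ λ ν x′ y = η⁻¹(hker μ λ (x′ + e_ν) y − hker μ λ x′ y)`, the
`η`-lattice forward difference in `x′` of the kernel `B5Hk163Torus.hker` of `H_k`.
[cite: Balaban1984PropagatorsI, (1.31) p.23 (∂_ν); (1.63) p.28 (momentum display; torus reading ours)] [folklore] -/
def dker (μ lam ν : Fin d) (x : Tor (fine n M)) (y : Tor M) : ℂ :=
  (n : ℂ) * (hker n M μ lam (x + unitVec (fine n M) ν) y - hker n M μ lam x y)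

/-- the matrix entry of `∂_νH_k = fdiff (fine n M) n ν * HkOp n M` IS `dker`. [folklore] -/
theorem fdiff_HkOp_apply (μ lam ν : Fin d) (x : Tor (fine n M)) (y : Tor M) :
    (fdiff (fine n M) (n : ℂ) ν * HkOp n M) (x, μ) (y, lam) = dker n M μ lam ν x y := by
  have h : (fdiff (fine n M) (n : ℂ) ν * HkOp n M) (x, μ) (y, lam)
      = (fdiff (fine n M) (n : ℂ) ν *ᵥ fun i => HkOp n M i (y, lam)) (x, μ) := by
    simp only [Matrix.mul_apply, Matrix.mulVec, dotProduct]
  rw [h, fdiff_mulVec_apply, sdiff_mulVec]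
  rfl

/-- `∂_ν(H_kB)_μ(x′) = Σ_y Σ_λ dker μ λ ν x′ y · B_λ(y)` for every unit-lattice 1-form `B`. [folklore] -/
theorem fdiff_HkOp_mulVec (B : Tor M × Fin d → ℂ) (ν : Fin d) (x : Tor (fine n M)) (μ : Fin d) :
    (fdiff (fine n M) (n : ℂ) ν *ᵥ (HkOp n M *ᵥ B)) (x, μ)
      = ∑ y : Tor M, ∑ lam : Fin d, dker n M μ lam ν x y * B (y, lam) := by
  rw [fdiff_mulVec_apply, sdiff_mulVec]
  simp only [comp, HkOp_mulVec, dker]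
  rw [← Finset.sum_sub_distrib, Finset.mul_sum]
  refine Finset.sum_congr rfl fun y _ => ?_
  rw [← Finset.sum_sub_distrib, Finset.mul_sum]
  refine Finset.sum_congr rfl fun lam _ => ?_
  ring

/-- **THE MOMENTUM FORM OF THE KERNEL OF `∂_νH_k`**:
`dker μ λ ν x′ y = |T₁|⁻¹ Σ_{(l,p′)} e^{i(p′+l)·x′} · ∂_ν(p′+l) · e^{−ip′·y} · h_{l;μλ}(p′)` — the forward difference
acts on the fine character `e^{i(p′+l)·x′}` by the factor `η⁻¹(e^{iη(p′_ν+l_ν)} − 1) = ∂_ν(p′+l)` ((1.31);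
`B5Prop11Fiber.dSym`, `B5Block118.dSym_eq_om`).
[cite: Balaban1984PropagatorsI, (1.31) p.23; (1.63) p.28 (momentum display; position-space torus reading and normalisation ours)] [folklore] -/
theorem dker_eq (μ lam ν : Fin d) (x : Tor (fine n M)) (y : Tor M) :
    dker n M μ lam ν x y = ((Fintype.card (Tor M) : ℂ))⁻¹ *
      ∑ kq : (Fin d → Fin n) × Tor M,
        chi (fine n M) (pOf n M kq) x * dSym n kq.1 (sOf M kq.2) ν * conj (chi M kq.2 y) *
          h163 n μ lam kq.1 (ofRealVec (sOf M kq.2)) := by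
  have hterm : ∀ kq : (Fin d → Fin n) × Tor M,
      (n : ℂ) * (chi (fine n M) (pOf n M kq) (x + unitVec (fine n M) ν) * conj (chi M kq.2 y) *
            h163 n μ lam kq.1 (ofRealVec (sOf M kq.2))
          - chi (fine n M) (pOf n M kq) x * conj (chi M kq.2 y) * h163 n μ lam kq.1 (ofRealVec (sOf M kq.2)))
        = chi (fine n M) (pOf n M kq) x * dSym n kq.1 (sOf M kq.2) ν * conj (chi M kq.2 y) *
          h163 n μ lam kq.1 (ofRealVec (sOf M kq.2)) := by
    rintro ⟨k, q⟩
    dsimp only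
    rw [chi_add_right, chi_pOf_unitVec, dSym_eq_om]
    ring
  unfold dker hker
  rw [← mul_sub, ← Finset.sum_sub_distrib, mul_left_comm]
  congr 1
  rw [Finset.mul_sum]
  exact Finset.sum_congr rfl fun kq _ => hterm kq

/-- **SUP BOUND OF THE KERNEL OF `∂_νH_k`**: `|∂_νH_k((x′,μ),(y,λ))| ≤ C_H(d, 0)`, uniformly in `n ≥ 1`, the period
vector `M`, `x′` and `y` — per torus momentum `p′` the alias sum `Σ_l |h_{l;μλ}(p′)|·|∂_ν(p′+l)|` is the weighted
alias sum at `α = 0` (`B5Hk163Holder.weighted_alias_sum_le_real`), and `|T₁|⁻¹Σ_{p′} 1 = 1`.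
[cite: Balaban1984PropagatorsI, p.29 lines 1–2 (text only; bound and constant ours)] [folklore] -/
theorem norm_dker_le (μ lam ν : Fin d) (x : Tor (fine n M)) (y : Tor M) :
    ‖dker n M μ lam ν x y‖ ≤ CHolder163 d 0 := by
  have hcard : (0 : ℝ) < Fintype.card (Tor M) := by exact_mod_cast Fintype.card_pos
  have hq : ∀ q : Tor M, ∑ k : Fin d → Fin n,
      ‖h163 n μ lam k (ofRealVec (sOf M q))‖ * ‖dSym n k (sOf M q) ν‖ ≤ CHolder163 d 0 := by
    intro q
    have h := weighted_alias_sum_le_real n (sOf_mem_BZ M q) μ lam ν le_rfl zero_lt_one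
    simpa only [wt163, zero_div, Real.rpow_zero, mul_one, dC_ofReal] using h
  have h2 : ∀ kq : (Fin d → Fin n) × Tor M,
      ‖chi (fine n M) (pOf n M kq) x * dSym n kq.1 (sOf M kq.2) ν * conj (chi M kq.2 y) *
          h163 n μ lam kq.1 (ofRealVec (sOf M kq.2))‖
        = ‖h163 n μ lam kq.1 (ofRealVec (sOf M kq.2))‖ * ‖dSym n kq.1 (sOf M kq.2) ν‖ := by
    intro kq
    rw [norm_mul, norm_mul, norm_mul, norm_chi, Complex.norm_conj, norm_chi]
    ring
  rw [dker_eq, norm_mul, norm_inv, Complex.norm_natCast]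
  refine (mul_le_mul_of_nonneg_left (norm_sum_le _ _) (inv_nonneg.mpr hcard.le)).trans ?_
  simp_rw [h2]
  rw [Fintype.sum_prod_type, Finset.sum_comm]
  calc (Fintype.card (Tor M) : ℝ)⁻¹ *
        ∑ q : Tor M, ∑ k : Fin d → Fin n, ‖h163 n μ lam k (ofRealVec (sOf M q))‖ * ‖dSym n k (sOf M q) ν‖
      ≤ (Fintype.card (Tor M) : ℝ)⁻¹ * ∑ _q : Tor M, CHolder163 d 0 :=
        mul_le_mul_of_nonneg_left (Finset.sum_le_sum fun q _ => hq q) (inv_nonneg.mpr hcard.le)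
    _ = CHolder163 d 0 := by
        rw [Finset.sum_const, Finset.card_univ, nsmul_eq_mul, ← mul_assoc, inv_mul_cancel₀ hcard.ne', one_mul]

/-- operator form of the sup bound: `|∂_ν(H_kB)_μ(x′)| ≤ C_H(d,0)·Σ_{y,λ}|B_λ(y)|`. [folklore] -/
theorem norm_fdiff_HkOp_mulVec_le (B : Tor M × Fin d → ℂ) (μ ν : Fin d) (x : Tor (fine n M)) :
    ‖(fdiff (fine n M) (n : ℂ) ν *ᵥ (HkOp n M *ᵥ B)) (x, μ)‖
      ≤ CHolder163 d 0 * ∑ y : Tor M, ∑ lam : Fin d, ‖B (y, lam)‖ := by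
  rw [fdiff_HkOp_mulVec, Finset.mul_sum]
  refine (norm_sum_le _ _).trans (Finset.sum_le_sum fun y _ => ?_)
  rw [Finset.mul_sum]
  refine (norm_sum_le _ _).trans (Finset.sum_le_sum fun lam _ => ?_)
  rw [norm_mul]
  exact mul_le_mul_of_nonneg_right (norm_dker_le n M μ lam ν x y) (norm_nonneg _)

end Operator

/-! ## §3. The Hölder bound -/

section Holder

variable (n : ℕ) [NeZero n] (M : Fin d → ℕ) [hM : ∀ μ, NeZero (M μ)]

/-- THE CONSTANT `C_HT(d, α) = 2^{1−α}·(π/2)^α·C_H(d, α)` of the Hölder bound (ours; depends on `d` and `α` only,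
hence the bound is uniform in `n = L^k` and in the period vector `M`). [folklore] -/
def CHolderTorus (d : ℕ) (α : ℝ) : ℝ := (2 : ℝ) ^ (1 - α) * (π / 2) ^ α * CHolder163 d α

/-- the Hölder difference of the kernel in momentum form:
`dker(x′ + z̄) − dker(x′) = |T₁|⁻¹ Σ_{(l,p′)} e^{i(p′+l)·x′}(e^{i(p′+l)·ηz} − 1) ∂_ν(p′+l) e^{−ip′y} h_{l;μλ}(p′)`.
[folklore] -/
theorem dker_transl_sub (μ lam ν : Fin d) (x : Tor (fine n M)) (y : Tor M) (z : Fin d → ℤ) :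
    dker n M μ lam ν (x + toT (fine n M) z) y - dker n M μ lam ν x y
      = ((Fintype.card (Tor M) : ℂ))⁻¹ * ∑ kq : (Fin d → Fin n) × Tor M,
          chi (fine n M) (pOf n M kq) x * (chi (fine n M) (pOf n M kq) (toT (fine n M) z) - 1) *
            dSym n kq.1 (sOf M kq.2) ν * conj (chi M kq.2 y) * h163 n μ lam kq.1 (ofRealVec (sOf M kq.2)) := by
  rw [dker_eq, dker_eq, ← mul_sub, ← Finset.sum_sub_distrib]
  congr 1
  refine Finset.sum_congr rfl fun kq _ => ?_
  rw [chi_add_right]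
  ring

/-- **THE HÖLDER BOUND FOR THE KERNEL OF THE TYPED `∂_νH_k`**: for `d ≥ 1`, every `n ≥ 1`, every period vector
`M`, all `μ, λ, ν`, all `x′ ∈ T_η`, `y ∈ T₁`, every integer displacement `z ∈ ℤ^d` and `0 ≤ α < 1`,
`|∂_νH_k((x′ + z̄, μ), (y, λ)) − ∂_νH_k((x′, μ), (y, λ))| ≤ C_HT(d, α) · (‖z‖₂/n)^α`.
Per alias `(l, p′)` the phase bound gives `2^{1−α}(‖z‖₂/n)^α · |h_{l;μλ}(p′)|·|∂_ν(p′+l)|·|q̃_l|^α`; per torus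
momentum `p′` the `l`-sum is the printed weighted alias sum (`B5Hk163HolderEuclid.weighted_alias_sum_le_euclid`);
then `|T₁|⁻¹Σ_{p′} 1 = 1`.
[cite: Balaban1984PropagatorsI, p.29 lines 1–2 «This implies bounds on (1/|x′−x|^α)|∂_ν(H_kB)_μ(x′) − ∂_ν(H_kB)_μ(x)| (see the proof of Lemma 2.4 in [2].)» (text of the claim only; typed form, proof and constant ours)] [folklore] -/
theorem norm_dker_transl_sub_le (μ lam ν : Fin d) (x : Tor (fine n M)) (y : Tor M) (z : Fin d → ℤ) {α : ℝ}
    (hα0 : 0 ≤ α) (hα1 : α < 1) :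
    ‖dker n M μ lam ν (x + toT (fine n M) z) y - dker n M μ lam ν x y‖ ≤ CHolderTorus d α * (zlen z / n) ^ α := by
  have hcard : (0 : ℝ) < Fintype.card (Tor M) := by exact_mod_cast Fintype.card_pos
  have hπ := Real.pi_pos
  set K : ℝ := (2 : ℝ) ^ (1 - α) * (zlen z / n) ^ α with hK
  have hK0 : 0 ≤ K := mul_nonneg (Real.rpow_nonneg (by norm_num) _)
    (Real.rpow_nonneg (div_nonneg (zlen_nonneg z) (Nat.cast_nonneg n)) _)
  have hF : ∀ kq : (Fin d → Fin n) × Tor M,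
      ‖chi (fine n M) (pOf n M kq) x * (chi (fine n M) (pOf n M kq) (toT (fine n M) z) - 1) *
          dSym n kq.1 (sOf M kq.2) ν * conj (chi M kq.2 y) * h163 n μ lam kq.1 (ofRealVec (sOf M kq.2))‖
        ≤ K * (‖h163 n μ lam kq.1 (ofRealVec (sOf M kq.2))‖ *
            (‖dSym n kq.1 (sOf M kq.2) ν‖ * momSq (symmAlias n kq.1 (sOf M kq.2)) ^ (α / 2))) := by
    rintro ⟨k, q⟩
    dsimp only
    rw [norm_mul, norm_mul, norm_mul, norm_mul, norm_chi, Complex.norm_conj, norm_chi, one_mul, mul_one]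
    have hph := norm_chi_pOf_toT_sub_one_le n M k q z hα0 hα1.le
    calc ‖chi (fine n M) (pOf n M (k, q)) (toT (fine n M) z) - 1‖ * ‖dSym n k (sOf M q) ν‖ *
          ‖h163 n μ lam k (ofRealVec (sOf M q))‖
        ≤ ((2 : ℝ) ^ (1 - α) * momSq (symmAlias n k (sOf M q)) ^ (α / 2) * (zlen z / n) ^ α) *
          ‖dSym n k (sOf M q) ν‖ * ‖h163 n μ lam k (ofRealVec (sOf M q))‖ := by
          gcongr
      _ = K * (‖h163 n μ lam k (ofRealVec (sOf M q))‖ *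
            (‖dSym n k (sOf M q) ν‖ * momSq (symmAlias n k (sOf M q)) ^ (α / 2))) := by
          rw [hK]; ring
  have hG : ∑ kq : (Fin d → Fin n) × Tor M, ‖h163 n μ lam kq.1 (ofRealVec (sOf M kq.2))‖ *
        (‖dSym n kq.1 (sOf M kq.2) ν‖ * momSq (symmAlias n kq.1 (sOf M kq.2)) ^ (α / 2))
      ≤ (Fintype.card (Tor M) : ℝ) * ((π / 2) ^ α * CHolder163 d α) := by
    rw [Fintype.sum_prod_type, Finset.sum_comm]
    calc ∑ q : Tor M, ∑ k : Fin d → Fin n, ‖h163 n μ lam k (ofRealVec (sOf M q))‖ *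
            (‖dSym n k (sOf M q) ν‖ * momSq (symmAlias n k (sOf M q)) ^ (α / 2))
        ≤ ∑ _q : Tor M, ((π / 2) ^ α * CHolder163 d α) :=
          Finset.sum_le_sum fun q _ => weighted_alias_sum_le_euclid n (sOf_mem_BZ M q) μ lam ν hα0 hα1
      _ = (Fintype.card (Tor M) : ℝ) * ((π / 2) ^ α * CHolder163 d α) := by
          rw [Finset.sum_const, Finset.card_univ, nsmul_eq_mul]
  rw [dker_transl_sub, norm_mul, norm_inv, Complex.norm_natCast]
  refine (mul_le_mul_of_nonneg_left ((norm_sum_le _ _).trans (Finset.sum_le_sum fun kq _ => hF kq))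
    (inv_nonneg.mpr hcard.le)).trans ?_
  rw [← Finset.mul_sum]
  refine (mul_le_mul_of_nonneg_left (mul_le_mul_of_nonneg_left hG hK0) (inv_nonneg.mpr hcard.le)).trans ?_
  have hc0 : (Fintype.card (Tor M) : ℝ) ≠ 0 := hcard.ne'
  refine le_of_eq ?_
  calc (Fintype.card (Tor M) : ℝ)⁻¹ * (K * ((Fintype.card (Tor M) : ℝ) * ((π / 2) ^ α * CHolder163 d α)))
      = ((Fintype.card (Tor M) : ℝ)⁻¹ * (Fintype.card (Tor M) : ℝ)) * (K * ((π / 2) ^ α * CHolder163 d α)) := by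
        ring
    _ = K * ((π / 2) ^ α * CHolder163 d α) := by rw [inv_mul_cancel₀ hc0, one_mul]
    _ = CHolderTorus d α * (zlen z / n) ^ α := by rw [hK, CHolderTorus]; ring

/-- THE QUOTIENT FORM: for `z ≠ 0`,
`|∂_νH_k((x′+z̄,μ),(y,λ)) − ∂_νH_k((x′,μ),(y,λ))| / (η‖z‖₂)^α ≤ C_HT(d, α)` — the typed
`(1/|x′ − x|^α)|…|` of the printed sentence, at kernel level.
[cite: Balaban1984PropagatorsI, p.29 lines 1–2 (text only)] [folklore] -/
theorem holder_quotient_dker_le (μ lam ν : Fin d) (x : Tor (fine n M)) (y : Tor M) {z : Fin d → ℤ} (hz : z ≠ 0)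
    {α : ℝ} (hα0 : 0 ≤ α) (hα1 : α < 1) :
    ‖dker n M μ lam ν (x + toT (fine n M) z) y - dker n M μ lam ν x y‖ / (zlen z / n) ^ α
      ≤ CHolderTorus d α := by
  have hn : (0 : ℝ) < n := by exact_mod_cast Nat.pos_of_ne_zero (NeZero.ne n)
  have hpos : 0 < (zlen z / n) ^ α := Real.rpow_pos_of_pos (div_pos (zlen_pos hz) hn) _
  rw [div_le_iff₀ hpos]
  exact norm_dker_transl_sub_le n M μ lam ν x y z hα0 hα1

/-- the matrix-entry form: the Hölder bound for the entries of `fdiff (fine n M) n ν * HkOp n M`. [folklore] -/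
theorem norm_fdiff_HkOp_apply_sub_le (μ lam ν : Fin d) (x : Tor (fine n M)) (y : Tor M) (z : Fin d → ℤ) {α : ℝ}
    (hα0 : 0 ≤ α) (hα1 : α < 1) :
    ‖(fdiff (fine n M) (n : ℂ) ν * HkOp n M) (x + toT (fine n M) z, μ) (y, lam)
        - (fdiff (fine n M) (n : ℂ) ν * HkOp n M) (x, μ) (y, lam)‖ ≤ CHolderTorus d α * (zlen z / n) ^ α := by
  rw [fdiff_HkOp_apply, fdiff_HkOp_apply]
  exact norm_dker_transl_sub_le n M μ lam ν x y z hα0 hα1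

/-- **THE PRINTED CONSEQUENCE FOR THE TYPED OPERATOR** (our `ℓ¹(B)` form): for every unit-lattice 1-form `B`, every
fine point `x′`, every integer displacement `z` and `0 ≤ α < 1`,
`|∂_ν(H_kB)_μ(x′ + z̄) − ∂_ν(H_kB)_μ(x′)| ≤ C_HT(d, α)·(‖z‖₂/n)^α · Σ_{y,λ}|B_λ(y)|`, uniformly in `n` and `M`.
[cite: Balaban1984PropagatorsI, p.29 lines 1–2 «This implies bounds on (1/|x′−x|^α)|∂_ν(H_kB)_μ(x′) − ∂_ν(H_kB)_μ(x)| (see the proof of Lemma 2.4 in [2].)» (text of the claim only; typed form, proof and constants ours)] [folklore] -/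
theorem norm_fdiff_HkOp_mulVec_sub_le (B : Tor M × Fin d → ℂ) (μ ν : Fin d) (x : Tor (fine n M))
    (z : Fin d → ℤ) {α : ℝ} (hα0 : 0 ≤ α) (hα1 : α < 1) :
    ‖(fdiff (fine n M) (n : ℂ) ν *ᵥ (HkOp n M *ᵥ B)) (x + toT (fine n M) z, μ)
        - (fdiff (fine n M) (n : ℂ) ν *ᵥ (HkOp n M *ᵥ B)) (x, μ)‖
      ≤ CHolderTorus d α * (zlen z / n) ^ α * ∑ y : Tor M, ∑ lam : Fin d, ‖B (y, lam)‖ := by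
  rw [fdiff_HkOp_mulVec, fdiff_HkOp_mulVec, ← Finset.sum_sub_distrib]
  simp_rw [← Finset.sum_sub_distrib, ← sub_mul]
  rw [Finset.mul_sum]
  refine (norm_sum_le _ _).trans (Finset.sum_le_sum fun y _ => ?_)
  rw [Finset.mul_sum]
  refine (norm_sum_le _ _).trans (Finset.sum_le_sum fun lam _ => ?_)
  rw [norm_mul]
  exact mul_le_mul_of_nonneg_right (norm_dker_transl_sub_le n M μ lam ν x y z hα0 hα1) (norm_nonneg _)

end Holder

end

end Literature.MathematicalPhysics.QuantumFieldTheory.Balaban1983to89.B5Hk163TorusHolder
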